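import Literature.Barriers.AtomisticToContinuum.NoBVEstimatesMultiDExpansion
import HarnessLib

/-!
# Rauch's theorem from the Local Existence Theorem alone: the barrier `NoBVEstimatesMultiDBarrier`
reduced, per system, to small classical solutions with `O(ε)` bounds

Fourth brick of the programme to discharge `Rauch1986_smallAmplitudeExpansionL2`. The printed
proof of Rauch's Theorem [Rauch1986, pp. 482–483] uses, besides elementary steps and Brenner's
theorem, exactly one black box: the Local Existence Theorem [Rauch1986, p. 482] ("a unique
solution ... `φ ↦ u - ū` is `C^∞` ... finite speed of propagation"). With
`NoBVEstimatesMultiDExpansion.lean` (the `L²` expansion from ANY family of small `C²` classical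
solutions, by Duhamel's principle on the Fourier side) and the tree's discharges of the linear
step (`Rauch1986_linearL1EstimateForcesCommutation_holds`) and of finite propagation speed for
the linearised system (`hasPropagationSpeed_ofConstant_zeroth`), the black box shrinks to the
PURE EXISTENCE statement, per system and per datum:

  `SmallSolutionsNear S ū T φ`: for all small `ε > 0` there is a classical solution `u_ε` of (1)
  on `[0, T]` with data `ū + εφ`, `C²` on the closed slab, equal to `ū` for `‖x‖ > ρ`, with
  `‖u_ε - ū‖, ‖Du_ε‖, ‖D²u_ε‖ ≤ Kε` at interior times

(`ρ, K` independent of `ε`; a PREDICATE on `(S, ū, T, φ)`, not a named fact). This file proves: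

* `smallAmplitudeExpansion_of_smallSolutionsNear` — Rauch's `W^{1,1}` expansion (the body of
  `Rauch1986_smallAmplitudeExpansion`) for `(S, ū, T, φ)` from `SmallSolutionsNear S ū T φ`
  (`smallAmplitudeExpansionL2_of_smallSolutions` + the `L² → L¹` step on the fixed support,
  `integral_norm_le_of_sq_le`; the support of `v(T)` from `exists_speed_fourierSolution_eq_zero`);
* `jacobiansCommuteAt_of_smallSolutionsNear` — **Rauch's Theorem for one system**: if `S` is in
  Rauch's class at `ū`, `s > d/2 + 1`, the small-data `BV` estimate (2) holds at `ū` with time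
  `t̄`, and `SmallSolutionsNear S ū t̄ φ` for every `φ ∈ C_c^∞`, then (3) holds — the printed
  proof verbatim (`integral_norm_le_of_expansion`, `Rauch1986_linearL1EstimateForcesCommutation_holds`);
* `NoBVEstimatesMultiDBarrier_of_smallSolutionsNear` — hence the barrier follows from
  `∀ S ū (Rauch class) T > 0, φ ∈ C_c^∞, SmallSolutionsNear S ū T φ`, i.e. from the Local
  Existence Theorem in its weakest useful form (existence on `[0, T]` for small data, uniform
  support, `O(ε)` closeness in `C²`; [Kato1975], [Majda1984, Ch. 2 Thm 2.1–2.2],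
  [Taylor1981, Ch. IV Thm 5.6]) — no smooth dependence on the data is needed.

Everything is proved; no named fact and no `sorry` is introduced.

## References

* [Rauch1986] J. Rauch, Comm. Math. Phys. 106 (1986) 481–484: Local Existence Theorem and Proof
  of Theorem pp. 482–483.
* [Majda1984] A. Majda, *Compressible Fluid Flow and Systems of Conservation Laws in Several
  Space Variables* (1984), Ch. 2, Thm 2.1–2.2.
-/

noncomputable section

open MeasureTheory Set Filter Matrix FourierTransform Metric Complex
open scoped ENNReal NNReal ContDiff Topology RealInnerProductSpace Matrix.Norms.Operator

namespace Literature.Barriers.AtomisticToContinuum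

open Literature.Analysis.Fourier Literature.Analysis.FluidPDE Literature.Analysis.Calculus
  Literature.Analysis.FunctionSpaces QuasilinearSystem

variable {d k : ℕ}

namespace QuasilinearSystem

/-- **Small classical solutions near the constant state** (the content of the Local Existence
Theorem consumed by Rauch's proof, for one system, one time and one datum): for all sufficiently
small `ε > 0` a classical solution `u_ε` of (1) on `[0, T]` with Cauchy data `ū + εφ`, `C²` on the
closed slab, equal to `ū` for `‖x‖ > ρ`, and `O(ε)`-close to `ū` in `C²` at interior times
(`ρ, K` independent of `ε`). [cite: Rauch1986, Local Existence Theorem p. 482] -/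
def SmallSolutionsNear (S : QuasilinearSystem d k) (ubar : Fin k → ℝ) (T : ℝ)
    (φ : Space d → Fin k → ℝ) : Prop :=
  ∃ (u : ℝ → ℝ → Space d → Fin k → ℝ) (ρ K : ℝ), ∀ᶠ ε in 𝓝[>] (0 : ℝ),
    S.IsClassicalSolution T (u ε) ∧ (∀ x, u ε 0 x = ubar + ε • φ x) ∧
    ContDiffOn ℝ 2 (Function.uncurry (u ε)) (Icc 0 T ×ˢ univ) ∧
    (∀ t ∈ Icc 0 T, ∀ x : Space d, ρ < ‖x‖ → u ε t x = ubar) ∧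
    (∀ p : ℝ × Space d, p.1 ∈ Ioo 0 T → ‖u ε p.1 p.2 - ubar‖ ≤ K * ε ∧
      ‖fderiv ℝ (Function.uncurry (u ε)) p‖ ≤ K * ε ∧
      ‖fderiv ℝ (fun q => fderiv ℝ (Function.uncurry (u ε)) q) p‖ ≤ K * ε)

end QuasilinearSystem

/-- **The `L²` expansion for the given family** (the assembly of
`smallAmplitudeExpansionL2_of_smallSolutions`, keeping the identification of the solutions and
their support clause): with `v` the Fourier solution of the linearisation,
`∫ ‖∇u_ε(T) - ε∇v(T)‖² ≤ Cε⁴` for all small `ε > 0`. [cite: Rauch1986, Proof of Theorem p. 482] -/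
theorem expansionL2_of_family {S : QuasilinearSystem d k} {ubar : Fin k → ℝ} (hS : S.IsRauchClass ubar)
    {T : ℝ} (hT : 0 < T) {φ : Space d → Fin k → ℝ} (hφ : ContDiff ℝ ∞ φ) (hφc : HasCompactSupport φ)
    {u : ℝ → ℝ → Space d → Fin k → ℝ} {ρ K : ℝ}
    (hev : ∀ᶠ ε in 𝓝[>] (0 : ℝ),
      S.IsClassicalSolution T (u ε) ∧ (∀ x, u ε 0 x = ubar + ε • φ x) ∧
      ContDiffOn ℝ 2 (Function.uncurry (u ε)) (Icc 0 T ×ˢ univ) ∧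
      (∀ t ∈ Icc 0 T, ∀ x : Space d, ρ < ‖x‖ → u ε t x = ubar) ∧
      (∀ p : ℝ × Space d, p.1 ∈ Ioo 0 T → ‖u ε p.1 p.2 - ubar‖ ≤ K * ε ∧
        ‖fderiv ℝ (Function.uncurry (u ε)) p‖ ≤ K * ε ∧
        ‖fderiv ℝ (fun q => fderiv ℝ (Function.uncurry (u ε)) q) p‖ ≤ K * ε)) :
    ∃ C : ℝ, ∀ᶠ ε in 𝓝[>] (0 : ℝ),
      S.IsClassicalSolution T (u ε) ∧ (∀ x, u ε 0 x = ubar + ε • φ x) ∧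
      (∀ t ∈ Icc 0 T, ∀ x : Space d, ρ < ‖x‖ → u ε t x = ubar) ∧
      Integrable (fun x => ‖fderiv ℝ (u ε T) x - ε • fderiv ℝ
        (fourierSolution (S.A0 ubar) (fun j => S.A j ubar) (fderiv ℝ S.B ubar) φ T) x‖ ^ 2) ∧
      ∫ x, ‖fderiv ℝ (u ε T) x - ε • fderiv ℝ
        (fourierSolution (S.A0 ubar) (fun j => S.A j ubar) (fderiv ℝ S.B ubar) φ T) x‖ ^ 2 ≤
        C * ε ^ 4 := by
  -- the quadratic bounds for `Φ` and Brenner's bound for the symbol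
  obtain ⟨CΦ, r, hCΦ, hr, hΦ⟩ := exists_quadratic_bounds_of_fderiv_zero
    (contDiff_infty.1 (contDiff_remainderMap (S := S) (ubar := ubar)) 2)
    (remainderMap_zero S ubar) hasFDerivAt_remainderMap_zero.fderiv
  obtain ⟨C₀, hC0, hC₀⟩ := exists_symbolBound hS.linearization T
  refine ⟨d * (d * (k * (((k * C₀) * ((k * C₀) * ‖((S.A0 ubar)⁻¹).map (algebraMap ℝ ℂ)‖)) ^ 2 * T *
    (T * (k * ((CΦ * K ^ 2) ^ 2 * volume.real (closedBall (0 : Space d) ρ))))))), ?_⟩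
  have hsmall : ∀ᶠ ε in 𝓝[>] (0 : ℝ), K * ε < r := by
    have ht : Tendsto (fun ε : ℝ => K * ε) (𝓝[>] (0 : ℝ)) (𝓝 (K * 0)) :=
      ((continuous_const.mul continuous_id).tendsto 0).mono_left nhdsWithin_le_nhds
    rw [mul_zero] at ht
    exact ht (Iio_mem_nhds hr)
  filter_upwards [hev, hsmall, self_mem_nhdsWithin] with ε ⟨hsolε, hdata, h2, hsup, hb⟩ hKr hpos
  have hKε : 0 ≤ K * ε := (norm_nonneg _).trans (hb (T / 2, 0) ⟨by linarith, by linarith⟩).1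
  have hSS : SmallSol S ubar (u ε) T ρ K ε CΦ r :=
    { contDiffOn := h2
      supp := hsup
      Kε_nonneg := hKε
      C_nonneg := hCΦ
      quad := hΦ
      Kε_le := hKr.le
      b0 := fun p hp => (hb p hp).1
      b1 := fun p hp => (hb p hp).2.1
      b2 := fun p hp => (hb p hp).2.2 }
  obtain ⟨hint, hle⟩ := hSS.integral_norm_fderiv_sub_sq_le hS hsolε hT hφ hφc hdata hC0 hC₀
  refine ⟨hsolε, hdata, hsup, hint, hle.trans_eq ?_⟩
  ring

/-- **Rauch's `W^{1,1}` expansion for one system from small classical solutions**: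
`SmallSolutionsNear S ū T φ` gives a classical solution `v` of the linearisation with `v(0) = φ`,
`v(T)` compactly supported, and solutions `u_ε` with data `ū + εφ`, `u_ε(T) - ū` compactly
supported, `∫ ‖∇u_ε(T) - ε∇v(T)‖ ≤ Cε²` (the `L²` bound integrated over the fixed support,
`integral_norm_le_of_sq_le`; the support of `v(T)` from the finite propagation speed of the
linearised system). [cite: Rauch1986, Proof of Theorem pp. 482–483] -/
theorem smallAmplitudeExpansion_of_smallSolutionsNear {S : QuasilinearSystem d k}
    {ubar : Fin k → ℝ} (hS : S.IsRauchClass ubar) {T : ℝ} (hT : 0 < T)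
    {φ : Space d → Fin k → ℝ} (hφ : ContDiff ℝ ∞ φ) (hφc : HasCompactSupport φ)
    (hsol : S.SmallSolutionsNear ubar T φ) :
    ∃ v : ℝ → Space d → Fin k → ℝ,
      (S.linearization ubar).IsClassicalSolution T v ∧ (∀ x, v 0 x = φ x) ∧
      HasCompactSupport (v T) ∧
      ∃ (u : ℝ → ℝ → Space d → Fin k → ℝ) (C : ℝ), ∀ᶠ ε in 𝓝[>] (0 : ℝ),
        S.IsClassicalSolution T (u ε) ∧ (∀ x, u ε 0 x = ubar + ε • φ x) ∧
        HasCompactSupport (fun x => u ε T x - ubar) ∧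
        ∫ x, ‖fderiv ℝ (u ε T) x - ε • fderiv ℝ (v T) x‖ ≤ C * ε ^ 2 := by
  obtain ⟨u, ρ, K, hev⟩ := hsol
  set v := fourierSolution (S.A0 ubar) (fun j => S.A j ubar) (fderiv ℝ S.B ubar) φ with hv
  have hL : (S.linearization ubar).IsRauchClass 0 := hS.linearization
  have hvsol : (S.linearization ubar).IsClassicalSolution T v :=
    isClassicalSolution_fourierSolution hL hT hφ hφc
  have hv0 : ∀ x, v 0 x = φ x := fun x => fourierSolution_zero hφ hφc x
  -- the support of `v(T)`
  obtain ⟨R, hR⟩ := exists_eq_zero_of_norm_gt hφc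
  obtain ⟨c₂, -, hF₂⟩ := exists_speed_fourierSolution_eq_zero hL
  have hTmem : T ∈ Icc 0 T := ⟨hT.le, le_rfl⟩
  have hvT : ∀ x : Space d, R + c₂ * T < ‖x‖ → v T x = 0 :=
    fun x hx => hF₂ hT hφ hφc hR T hTmem x hx
  have hvTc : HasCompactSupport (v T) := by
    simpa using hasCompactSupport_sub_const_of_norm_gt hvT
  -- the `L²` expansion for the family
  obtain ⟨C, hevC⟩ := expansionL2_of_family hS hT hφ hφc hev
  -- the fixed support radius of the remainder gradients
  set ρ' : ℝ := max ρ (R + c₂ * T) with hρ'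
  refine ⟨v, hvsol, hv0, hvTc, u, C / 2 + (volume.real (closedBall (0 : Space d) ρ')) / 2, ?_⟩
  filter_upwards [hevC, self_mem_nhdsWithin] with ε ⟨hsolε, hdata, hsup, hint, hrem⟩ hpos
  have hε : 0 < ε := hpos
  have huT : ∀ x : Space d, ρ < ‖x‖ → u ε T x = ubar := fun x hx => hsup T hTmem x hx
  refine ⟨hsolε, hdata, hasCompactSupport_sub_const_of_norm_gt huT, ?_⟩
  -- the remainder gradient vanishes outside the ball of radius `ρ'` and is continuous
  have hsupp : ∀ x : Space d, ρ' < ‖x‖ → fderiv ℝ (u ε T) x - ε • fderiv ℝ (v T) x = 0 := by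
    intro x hx
    rw [fderiv_eq_zero_of_eq_const_of_norm_gt huT ((le_max_left _ _).trans_lt hx),
      fderiv_eq_zero_of_eq_const_of_norm_gt hvT ((le_max_right _ _).trans_lt hx), smul_zero,
      sub_zero]
  have hcont : Continuous fun x => fderiv ℝ (u ε T) x - ε • fderiv ℝ (v T) x :=
    ((hsolε.contDiff_slice hTmem).continuous_fderiv one_ne_zero).sub
      (((hvsol.contDiff_slice hTmem).continuous_fderiv one_ne_zero).const_smul ε)
  have hgi : Integrable fun x => fderiv ℝ (u ε T) x - ε • fderiv ℝ (v T) x := by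
    refine hcont.integrable_of_hasCompactSupport ?_
    refine HasCompactSupport.intro (isCompact_closedBall (0 : Space d) ρ') fun x hx => ?_
    rw [mem_closedBall_zero_iff, not_le] at hx
    exact hsupp x hx
  exact integral_norm_le_of_sq_le hε hgi hint hrem hsupp

/-- **Rauch's Theorem for one system from small classical solutions.** If `S` is in Rauch's
class at `ū`, `s > d/2 + 1`, the small-data `BV` estimate (2) holds at `ū`, and for every
`T > 0` and `φ ∈ C_c^∞` there are small classical solutions near `ū` with data `ū + εφ`
(`SmallSolutionsNear`), then the Jacobians commute at `ū` — the printed proof: the expansion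
(`smallAmplitudeExpansion_of_smallSolutionsNear`), "dividing by `ε` and letting `ε → 0`"
(`integral_norm_le_of_expansion`), and the linear step, discharged in the tree
(`Rauch1986_linearL1EstimateForcesCommutation_holds`).
[cite: Rauch1986, Theorem and Proof of Theorem pp. 482–483] -/
theorem jacobiansCommuteAt_of_smallSolutionsNear {S : QuasilinearSystem d k} {ubar : Fin k → ℝ}
    (hS : S.IsRauchClass ubar) {s : ℕ} (hBV : S.HasSmallDataBVEstimate ubar s)
    (hsol : ∀ ⦃T : ℝ⦄, 0 < T → ∀ φ : Space d → Fin k → ℝ, ContDiff ℝ ∞ φ → HasCompactSupport φ →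
      S.SmallSolutionsNear ubar T φ) :
    S.JacobiansCommuteAt ubar := by
  obtain ⟨c, T, η, hT, hη, hest⟩ := hBV
  refine Rauch1986_linearL1EstimateForcesCommutation_holds (S.A0 ubar) (fun j => S.A j ubar)
    (fderiv ℝ S.B ubar) hS.linearization (max c 1) T (lt_max_of_lt_right one_pos) hT ?_
  intro φ hφ hφc
  obtain ⟨v, hv, hv0, hvT, u, C, hev⟩ :=
    smallAmplitudeExpansion_of_smallSolutionsNear hS hT hφ hφc (hsol hT φ hφ hφc)
  refine ⟨v, hv, hv0, hvT, ?_⟩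
  -- `‖εφ‖²_{Hˢ} = ε²‖φ‖²_{Hˢ} < η²` for small `ε`
  have hsmall : ∀ᶠ ε in 𝓝[>] (0 : ℝ), hsNormSq s (ε • φ) < η ^ 2 := by
    have ht : Tendsto (fun ε : ℝ => ε ^ 2 * hsNormSq s φ) (𝓝 0) (𝓝 0) := by
      have := ((continuous_pow 2).mul continuous_const).tendsto (0 : ℝ)
        (f := fun ε : ℝ => ε ^ 2 * hsNormSq s φ)
      simpa using this
    have h2 : ∀ᶠ ε in 𝓝 (0 : ℝ), ε ^ 2 * hsNormSq s φ < η ^ 2 :=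
      ht.eventually_lt_const (by positivity)
    filter_upwards [h2.filter_mono (nhdsWithin_le_nhds (s := Ioi (0 : ℝ)))] with ε hε
    rwa [hsNormSq_const_smul hφ]
  have hpos : ∀ᶠ ε in 𝓝[>] (0 : ℝ), 0 < ε := eventually_mem_nhdsWithin
  have hP : ∀ {ε : ℝ}, 0 < ε → ∫ x, ‖fderiv ℝ (ε • φ) x‖ = ε * ∫ x, ‖fderiv ℝ φ x‖ := by
    intro ε hε
    rw [← MeasureTheory.integral_const_mul]
    refine integral_congr_ae (Eventually.of_forall fun x => ?_)
    have hdx : DifferentiableAt ℝ φ x := (hφ.differentiable (by simp)).differentiableAt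
    simp only
    rw [fderiv_const_smul hdx ε, norm_smul, Real.norm_eq_abs, abs_of_pos hε]
  have hiv : Integrable (fderiv ℝ (v T)) :=
    integrable_fderiv_of_hasCompactSupport (hv.contDiff_slice ⟨hT.le, le_rfl⟩) hvT
  refine integral_norm_le_of_expansion (g := fun ε => fderiv ℝ (u ε T)) (C := C) hiv ?_
  filter_upwards [hev, hsmall, hpos] with ε ⟨hsolε, hdata, hsupp, hrem⟩ hεs hε
  refine ⟨?_, ?_, hrem⟩
  · rw [fderiv_eq_fderiv_sub_const (u ε T) ubar]
    exact integrable_fderiv_of_hasCompactSupport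
      ((hsolε.contDiff_slice ⟨hT.le, le_rfl⟩).sub contDiff_const) hsupp
  · have hBVε := hest (ε • φ) (hφ.const_smul ε)
      (hφc.mono (Function.support_const_smul_subset ε φ)) hεs (u ε) hsolε
      (fun x => by rw [hdata x, Pi.smul_apply])
    rw [hP hε] at hBVε
    exact hBVε.trans (mul_le_mul_of_nonneg_right (le_max_left c 1)
      (mul_nonneg hε.le (integral_nonneg fun _ => norm_nonneg _)))

/-- **The barrier from the Local Existence Theorem alone**: `NoBVEstimatesMultiDBarrier` follows
from small classical solutions near the constant state for every system in Rauch's class, every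
`T > 0` and every datum `φ ∈ C_c^∞`. [cite: Rauch1986, Theorem and Local Existence Theorem p. 482] -/
theorem NoBVEstimatesMultiDBarrier_of_smallSolutionsNear
    (hQ : ∀ ⦃d k : ℕ⦄ (S : QuasilinearSystem d k) (ubar : Fin k → ℝ), S.IsRauchClass ubar →
      ∀ ⦃T : ℝ⦄, 0 < T → ∀ φ : Space d → Fin k → ℝ, ContDiff ℝ ∞ φ → HasCompactSupport φ →
        S.SmallSolutionsNear ubar T φ) :
    NoBVEstimatesMultiDBarrier :=
  fun _ _ S ubar _ hS _ hBV =>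
    jacobiansCommuteAt_of_smallSolutionsNear hS hBV fun _ hT φ hφ hφc => hQ S ubar hS hT φ hφ hφc

/-- The same existence statement also gives the named facts of the cone:
`Rauch1986_smallAmplitudeExpansionL2`. [cite: Rauch1986, Local Existence Theorem p. 482] -/
theorem Rauch1986_smallAmplitudeExpansionL2_of_smallSolutionsNear
    (hQ : ∀ ⦃d k : ℕ⦄ (S : QuasilinearSystem d k) (ubar : Fin k → ℝ), S.IsRauchClass ubar →
      ∀ ⦃T : ℝ⦄, 0 < T → ∀ φ : Space d → Fin k → ℝ, ContDiff ℝ ∞ φ → HasCompactSupport φ →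
        S.SmallSolutionsNear ubar T φ) :
    Rauch1986_smallAmplitudeExpansionL2 :=
  Rauch1986_smallAmplitudeExpansionL2_of_smallSolutions hQ

/-- ... and `Rauch1986_smallAmplitudeExpansion` (the `W^{1,1}` form).
[cite: Rauch1986, Local Existence Theorem and Proof of Theorem p. 482] -/
theorem Rauch1986_smallAmplitudeExpansion_of_smallSolutionsNear
    (hQ : ∀ ⦃d k : ℕ⦄ (S : QuasilinearSystem d k) (ubar : Fin k → ℝ), S.IsRauchClass ubar →
      ∀ ⦃T : ℝ⦄, 0 < T → ∀ φ : Space d → Fin k → ℝ, ContDiff ℝ ∞ φ → HasCompactSupport φ →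
        S.SmallSolutionsNear ubar T φ) :
    Rauch1986_smallAmplitudeExpansion :=
  fun _ _ S ubar hS _ hT φ hφ hφc =>
    smallAmplitudeExpansion_of_smallSolutionsNear hS hT hφ hφc (hQ S ubar hS hT φ hφ hφc)

end Literature.Barriers.AtomisticToContinuum

end
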